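import Literature.Analysis.FluidPDE.CriticalSpaces
import Literature.Analysis.FluidPDE.TaoLocalisation
import Mathlib.Analysis.Distribution.Sobolev
import HarnessLib

/-!
# Fefferman's data class (4) inside the Sobolev scale: Schwartz fields lie in every `H^s`

Reference tool for the cell `ns-claims` Clay-link column (keeper `ns-claims-lit-4`; theorems + one
plumbing `def`, no named facts). Many claim skeletons state their theorem for data `u₀ ∈ H^s(ℝ³)`,
typed through the tree predicate `IsDistributionOf` and Mathlib's Bessel-potential Sobolev spaces
`TemperedDistribution.MemSobolev s 2` (rows C143 `Guevremont2026`, C152 `PinheiroQueiroz2025`, …), or for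
`u₀ ∈ H¹` as square-integrability of `u₀` and `Du₀` (row C157 `Zeroual2026`), and then carry the inclusion
«Clay datum ⇒ printed datum» as an explicit hypothesis `ClayDelta`. This file proves that inclusion once:

* `HasRapidSpatialDecay.schwartzComplexify` — a smooth field `u₀ : ℝ^κ → ℝ^ι` with Fefferman's decay (4)
  (`HasRapidSpatialDecay`: every derivative decays faster than every polynomial) IS a Schwartz map after
  complexification of the target (`complexify ∘ u₀ : ℝ^κ → ℂ^ι`), as a bundled Mathlib `SchwartzMap`;
* `HasRapidSpatialDecay.isDistributionOf_schwartzComplexify` — its tempered distribution is the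
  distribution of `u₀` in the sense of `IsDistributionOf`;
* `HasRapidSpatialDecay.exists_isDistributionOf_memSobolev` — hence `u₀ ∈ H^s` for EVERY real `s`
  («The space S is obviously contained in all spaces H^s(ℝⁿ)», Agranovich 2015 §1.5; Mathlib
  `SchwartzMap.memSobolev`), in exactly the shape the skeletons type (`∃ U, IsDistributionOf u₀ U ∧
  MemSobolev s 2 U`);
* `HasRapidSpatialDecay.lintegral_enorm_sq_lt_top`, `…lintegral_enorm_fderiv_sq_lt_top`,
  `…memLp_two` — the `L²` forms (`∫‖u₀‖² < ∞`, `∫‖Du₀‖² < ∞`, `u₀ ∈ L²`) from the tree's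
  `HasRapidSpatialDecay.lintegral_enorm_iteratedFDeriv_sq_lt_top` (Tao 2013 §1 «Schwartz ⇒ H¹ ⇒ finite
  energy»).

## References
* C. L. Fefferman, *Existence and smoothness of the Navier–Stokes equation*, CMI (2006), hypothesis (4)
  p. 1. [FeffermanClay2006]
* M. S. Agranovich, *Sobolev Spaces, Their Generalizations and Elliptic Problems in Smooth and Lipschitz
  Domains*, Springer (2015), §1.1 (definition of `H^s(ℝⁿ)` via `(1+|ξ|²)^{s/2} û ∈ L²`) and §1.5 («S ⊂ H^s
  for all s»; Thm 1.5.1: `H^s` is the completion of `S`). [Agranovich2015]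
* T. Tao, *Localisation and compactness properties of the Navier–Stokes global regularity problem*,
  Anal. PDE 6 (2013), §1 p. 3. [Tao2011]

WHAT THIS IS NOT: not a claim about NS regularity or blow-up; not a claim about any author beyond the
typed locator.
-/

noncomputable section

open MeasureTheory
open scoped ContDiff ENNReal SchwartzMap

namespace Literature.Analysis.FluidPDE

variable {κ ι : Type*} [Fintype κ] [Fintype ι]

/-- **Fefferman's (4) ⇒ Schwartz.** The complexified field `complexify ∘ u₀` of a smooth field with rapid
decay of all derivatives, as a Mathlib Schwartz map: (4) gives `(1+‖x‖)^k ‖Dⁿu₀(x)‖ ≤ C_{n,k}`, hence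
`‖x‖^k ‖Dⁿ(complexify ∘ u₀)(x)‖ ≤ C_{n,k}` (the complexification is a real linear isometry, so the
derivative norms agree). Plumbing `def`; same device as the tree's `FourierNS.schwartzData`.
[cite: FeffermanClay2006, (4) p.1] -/
def HasRapidSpatialDecay.schwartzComplexify {u₀ : EuclideanSpace ℝ κ → EuclideanSpace ℝ ι}
    (hs : ContDiff ℝ ∞ u₀) (hdec : HasRapidSpatialDecay u₀) :
    𝓢(EuclideanSpace ℝ κ, EuclideanSpace ℂ ι) where
  toFun := FunctionSpaces.EuclideanSpace.complexify ∘ u₀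
  smooth' := FunctionSpaces.EuclideanSpace.contDiff_complexify_comp_iff.2 hs
  decay' k n := by
    obtain ⟨C, hC⟩ := hdec n k
    refine ⟨C, fun x => ?_⟩
    rw [LinearIsometry.norm_iteratedFDeriv_comp_left _ hs.contDiffAt (mod_cast le_top)]
    calc ‖x‖ ^ k * ‖iteratedFDeriv ℝ n u₀ x‖ ≤ (1 + ‖x‖) ^ k * ‖iteratedFDeriv ℝ n u₀ x‖ := by
          gcongr; linarith [norm_nonneg x]
      _ ≤ C := hC x

/-- Values of `schwartzComplexify` (private plumbing; outside this file unfold the `def`). [folklore] -/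
@[simp] private theorem HasRapidSpatialDecay.schwartzComplexify_apply
    {u₀ : EuclideanSpace ℝ κ → EuclideanSpace ℝ ι} (hs : ContDiff ℝ ∞ u₀) (hdec : HasRapidSpatialDecay u₀)
    (x : EuclideanSpace ℝ κ) :
    hdec.schwartzComplexify hs x = FunctionSpaces.EuclideanSpace.complexify (u₀ x) :=
  rfl

/-- **The tempered distribution of a class-(4) field is the distribution of the field**: for every
Schwartz test function `φ`, `φ • (complexify ∘ u₀)` is integrable (Schwartz × bounded) and the Schwartz
map `complexify ∘ u₀`, viewed in `𝓢'`, pairs with `φ` as `∫ φ • complexify ∘ u₀`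
(Mathlib `SchwartzMap.coe_apply`). [cite: Agranovich2015, §1.1–§1.5 (S ⊂ 𝓢')] -/
theorem HasRapidSpatialDecay.isDistributionOf_schwartzComplexify
    {u₀ : EuclideanSpace ℝ κ → EuclideanSpace ℝ ι} (hs : ContDiff ℝ ∞ u₀) (hdec : HasRapidSpatialDecay u₀) :
    IsDistributionOf u₀
      ((hdec.schwartzComplexify hs : 𝓢(EuclideanSpace ℝ κ, EuclideanSpace ℂ ι)) :
        𝓢'(EuclideanSpace ℝ κ, EuclideanSpace ℂ ι)) := by
  intro φ
  refine ⟨?_, ?_⟩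
  · have h1 : Integrable (fun x => φ x) (volume : Measure (EuclideanSpace ℝ κ)) := φ.integrable
    have h2 : MemLp (fun x => hdec.schwartzComplexify hs x) ∞
        (volume : Measure (EuclideanSpace ℝ κ)) := (hdec.schwartzComplexify hs).memLp ⊤
    exact h1.smul_of_top_left h2
  · rw [SchwartzMap.coe_apply]
    rfl

/-- **Schwartz ⊂ H^s for every `s`** («The space S is obviously contained in all spaces H^s(ℝⁿ)»):
the tempered distribution of a class-(4) field lies in Mathlib's Sobolev space `H^{s,2}` for every real
`s` (`SchwartzMap.memSobolev`). [cite: Agranovich2015, §1.5 (sentence before Thm 1.5.1) and Thm 1.5.1] -/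
theorem HasRapidSpatialDecay.memSobolev_schwartzComplexify
    {u₀ : EuclideanSpace ℝ κ → EuclideanSpace ℝ ι} (hs : ContDiff ℝ ∞ u₀) (hdec : HasRapidSpatialDecay u₀)
    (s : ℝ) :
    TemperedDistribution.MemSobolev s 2
      ((hdec.schwartzComplexify hs : 𝓢(EuclideanSpace ℝ κ, EuclideanSpace ℂ ι)) :
        𝓢'(EuclideanSpace ℝ κ, EuclideanSpace ℂ ι)) :=
  (hdec.schwartzComplexify hs).memSobolev

/-- **A Clay datum is an `H^s` datum for every `s`**, in the shape the claim skeletons type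
(`∃ U ∈ 𝓢', IsDistributionOf u₀ U ∧ MemSobolev s 2 U` — e.g. `Guevremont2026.InHs`,
`PinheiroQueiroz2025.InHs`). [cite: FeffermanClay2006, (4) p.1]
[cite: Agranovich2015, §1.5 (S ⊂ H^s for all s) and Thm 1.5.1] -/
theorem HasRapidSpatialDecay.exists_isDistributionOf_memSobolev
    {u₀ : EuclideanSpace ℝ κ → EuclideanSpace ℝ ι} (hs : ContDiff ℝ ∞ u₀) (hdec : HasRapidSpatialDecay u₀)
    (s : ℝ) :
    ∃ U : 𝓢'(EuclideanSpace ℝ κ, EuclideanSpace ℂ ι),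
      IsDistributionOf u₀ U ∧ TemperedDistribution.MemSobolev s 2 U :=
  ⟨_, hdec.isDistributionOf_schwartzComplexify hs, hdec.memSobolev_schwartzComplexify hs s⟩

/-- **Finite energy of a class-(4) field**: `∫ ‖u₀‖² < ∞` (Tao 2013 §1 «the Schwartz property implies H¹,
which in turn implies finite energy»; the tree's `lintegral_enorm_iteratedFDeriv_sq_lt_top` at `n = 0`).
[cite: Tao2011, §1 p. 3] [cite: FeffermanClay2006, (4) p.1] -/
theorem HasRapidSpatialDecay.lintegral_enorm_sq_lt_top
    {E F : Type*} [NormedAddCommGroup E] [InnerProductSpace ℝ E] [FiniteDimensional ℝ E]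
    [MeasurableSpace E] [BorelSpace E] [NormedAddCommGroup F] [NormedSpace ℝ F] {μ : Measure E}
    [μ.IsAddHaarMeasure] {u₀ : E → F} (hdec : HasRapidSpatialDecay u₀) :
    (∫⁻ x, ‖u₀ x‖ₑ ^ 2 ∂μ) < ⊤ := by
  have h0 := hdec.lintegral_enorm_iteratedFDeriv_sq_lt_top (μ := μ) 0
  have heq : (fun x => ‖iteratedFDeriv ℝ 0 u₀ x‖ₑ ^ 2) = fun x => ‖u₀ x‖ₑ ^ 2 := by
    funext x
    rw [← ofReal_norm, ← ofReal_norm, norm_iteratedFDeriv_zero]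
  rwa [heq] at h0

/-- **Finite enstrophy-type bound of a class-(4) field**: `∫ ‖Du₀‖² < ∞` (the same lemma at `n = 1`,
`‖D¹u₀(x)‖ = ‖Du₀(x)‖`). [cite: Tao2011, §1 p. 3] [cite: FeffermanClay2006, (4) p.1] -/
theorem HasRapidSpatialDecay.lintegral_enorm_fderiv_sq_lt_top
    {E F : Type*} [NormedAddCommGroup E] [InnerProductSpace ℝ E] [FiniteDimensional ℝ E]
    [MeasurableSpace E] [BorelSpace E] [NormedAddCommGroup F] [NormedSpace ℝ F] {μ : Measure E}
    [μ.IsAddHaarMeasure] {u₀ : E → F} (hdec : HasRapidSpatialDecay u₀) :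
    (∫⁻ x, ‖fderiv ℝ u₀ x‖ₑ ^ 2 ∂μ) < ⊤ := by
  have h1 := hdec.lintegral_enorm_iteratedFDeriv_sq_lt_top (μ := μ) 1
  have heq : (fun x => ‖iteratedFDeriv ℝ 1 u₀ x‖ₑ ^ 2) = fun x => ‖fderiv ℝ u₀ x‖ₑ ^ 2 := by
    funext x
    rw [← ofReal_norm, ← ofReal_norm, ← norm_iteratedFDeriv_fderiv, norm_iteratedFDeriv_zero]
  rwa [heq] at h1

/-- **A continuous class-(4) field is in `L²`** (`MemLp u₀ 2`). [cite: Tao2011, §1 p. 3]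
[cite: FeffermanClay2006, (4) p.1] -/
theorem HasRapidSpatialDecay.memLp_two
    {E F : Type*} [NormedAddCommGroup E] [InnerProductSpace ℝ E] [FiniteDimensional ℝ E]
    [MeasurableSpace E] [BorelSpace E] [NormedAddCommGroup F] [NormedSpace ℝ F] {μ : Measure E}
    [μ.IsAddHaarMeasure] {u₀ : E → F} (hcont : Continuous u₀) (hdec : HasRapidSpatialDecay u₀) :
    MemLp u₀ 2 μ := by
  refine ⟨hcont.aestronglyMeasurable, ?_⟩
  rw [eLpNorm_lt_top_iff_lintegral_rpow_enorm_lt_top (by norm_num) (by norm_num)]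
  simpa using hdec.lintegral_enorm_sq_lt_top (μ := μ)

end Literature.Analysis.FluidPDE

end
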